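import Summits.CriticalPhenomena.PercolationContinuityZ3.Theorems.SahiMasterFamilyPhiVertex
import Summits.CriticalPhenomena.PercolationContinuityZ3.Theorems.SahiMasterFamilyTensorisation

/-!
# Pointwise PRODUCTS of set functions: hereditary Sahi positivity × quotient positivity ⇒ positivity (every order),
# and segment points `1_𝒰 + w·1_{𝒰ᶜ}` are quotient-positive

Unit `prim-masterthm-p4` (gen 14; crux anchor stmt-CriticalPhenomena-4575, helper work; memo
`run/shared/lean/prim/prim-masterthm/prim-masterthm-p4/P4-GEN14-REPORT.md` §4).  Companion of `…PhiVertex`, `…PhiScale`,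
`…PhiSegment` and of the cell's law of total cumulance `…Tensorisation` (gen 3: `sahiE_prod_tensor_eq`, any real weights).

**THEOREM** `phiSet_mul_nonneg` (every order).  Let `a, b : Finset (Fin (n+1)) → ℝ`.  Suppose every RESTRICTION of `a` is
Sahi-nonnegative (`Φ_L(S ↦ a(e S)) ≥ 0` for every embedding `e : Fin L ↪ Fin (n+1)`) and every QUOTIENT of `b` is Sahi-nonnegative
(`Φ_L(Q ↦ b(⋃_{m∈Q} B_m)) ≥ 0` for every family of pairwise disjoint blocks `B : Fin L → Finset (Fin (n+1))`).  Then the pointwise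
product has `Φ_{n+1}(S ↦ a S · b S) ≥ 0`.  (The law of total cumulance in the product of the two canonical signed models
`realW a ⊗ realW b` with slots `realF_i ⊗ realF_i`, whose mixed moments are `a_S b_S`: `sahiE_prod_tensor_eq` writes `Φ(a·b)` as a sum
over set partitions of [product over blocks of restricted functionals of `a`] × [a quotient functional of `b`].)

Used with `…PhiSegment` (segment points `1_𝒰 + w·1_{𝒰ᶜ}` are quotient-positive, a quotient of a segment point being the segment
point of the pulled-back union-closed family) this is the engine behind `F(n)` on all MIN-CLOSED points (`…PhiMinClosed`).
HONEST FRAMING: structural; `PhiNonneg n` (n ≥ 8), Sahi's `C_k`, Kahn's Conjecture 5, the master theorem remain OPEN.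
Axioms standard. [this work]
-/

noncomputable section

open scoped Classical

namespace Summit.CriticalPhenomena.PercolationContinuityZ3.Theorems

namespace PhiProduct

open Finset Function
open Literature.Combinatorics.Sahi2008
open Literature.Combinatorics.Sahi2008.PartitionForm
open PrincipalCapBeta (phiSet realF realW)

variable {n : ℕ}

/-! ### `Φ_0 ≥ 0` and the two conversions `sahiE ↔ Φ` -/

/-- `Φ_0(m) = 1 ≥ 0` (the unique ordered partition of `0` has no blocks). [this work] -/
theorem phiSet_zero_nonneg (m : Finset (Fin 0) → ℝ) : 0 ≤ phiSet 0 m := by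
  unfold PrincipalCapBeta.phiSet
  refine sum_nonneg fun c _ => ?_
  have hl : c.length = 0 := by
    by_contra h
    obtain ⟨l, hl⟩ : ∃ l : ℕ, c.length = l + 1 := Nat.exists_eq_succ_of_ne_zero h
    have j : Fin c.length := Fin.cast hl.symm 0
    exact Fin.elim0 (c.emb j (Fin.cast (by simp) (⟨0, c.partSize_pos j⟩ : Fin (c.partSize j))))
  have hprod : ∏ j : Fin c.length, (((c.partSize j - 1).factorial : ℝ) * m (PartitionForm.block c j)) = 1 := by
    haveI : IsEmpty (Fin c.length) := by rw [hl]; infer_instance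
    rw [Finset.univ_eq_empty, prod_empty]
  rw [hprod, mul_one, hl]
  norm_num

/-- **Restricted functionals in the signed model**: `E^{realW a}_L(realF ∘ e) = Φ_L(S ↦ a(e S))`, so it is `≥ 0` under the
restriction hypothesis. [this work] -/
theorem sahiE_realF_emb_nonneg (a : Finset (Fin n) → ℝ) :
    ∀ (L : ℕ) (e : Fin L ↪ Fin n), 0 ≤ phiSet L (fun S => a (S.map e)) → 0 ≤ sahiE (realW a) L (fun j => realF (e j))
  | 0, _, _ => by rw [sahiE_zero]
  | L + 1, e, h => by
    rw [PrincipalCapBeta.sahiE_eq_phiSet]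
    have e1 : (fun B : Finset (Fin (L + 1)) => ex (realW a) (∏ x ∈ B, (fun j => (realF (e j) : Finset (Fin n) → ℝ)) x)) =
        fun S => a (S.map e) := by
      funext B
      show ex (realW a) (∏ x ∈ B, (realF (e x) : Finset (Fin n) → ℝ)) = a (B.map e)
      rw [← Finset.prod_map B e realF, PrincipalCapBeta.ex_realW_prod]
    rw [e1]; exact h

/-- **Quotient functionals in the signed model**: for pairwise disjoint blocks `B_m`,
`E^{realW b}_L(∏_{i∈B_m} realF_i : m) = Φ_L(Q ↦ b(⋃_{m∈Q} B_m))`, so it is `≥ 0` under the quotient hypothesis. [this work] -/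
theorem sahiE_realF_blocks_nonneg (b : Finset (Fin n) → ℝ) :
    ∀ (L : ℕ) (B : Fin L → Finset (Fin n)), (∀ i j, i ≠ j → Disjoint (B i) (B j)) →
      0 ≤ phiSet L (fun Q => b (Q.biUnion B)) →
        0 ≤ sahiE (realW b) L (fun m => ∏ i ∈ B m, (realF i : Finset (Fin n) → ℝ))
  | 0, _, _, _ => by rw [sahiE_zero]
  | L + 1, B, hdisj, h => by
    rw [PrincipalCapBeta.sahiE_eq_phiSet]
    have e1 : (fun Q : Finset (Fin (L + 1)) => ex (realW b) (∏ x ∈ Q, (fun m => ∏ i ∈ B m, (realF i : Finset (Fin n) → ℝ)) x)) =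
        fun Q => b (Q.biUnion B) := by
      funext Q
      show ex (realW b) (∏ x ∈ Q, ∏ i ∈ B x, (realF i : Finset (Fin n) → ℝ)) = b (Q.biUnion B)
      rw [← Finset.prod_biUnion (fun i _ j _ hij => hdisj i j hij), PrincipalCapBeta.ex_realW_prod]
    rw [e1]; exact h

/-- Distinct blocks of a set partition are disjoint. [folklore] -/
theorem block_disjoint {N : ℕ} (c : OrderedFinpartition N) {i j : Fin c.length} (hij : i ≠ j) :
    Disjoint (block c i) (block c j) := by
  rw [Finset.disjoint_left]
  intro x hx hx'
  unfold PartitionForm.block at hx hx'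
  exact hij ((mem_filter.1 hx).2.symm.trans (mem_filter.1 hx').2)

/-! ### The product theorem -/

/-- Moments of the tensor family: `E^{realW a ⊗ realW b}(∏_{i∈B} realF_i ⊗ realF_i) = a_B · b_B`. [this work] -/
theorem ex_tensor_prod (a b : Finset (Fin n) → ℝ) (B : Finset (Fin n)) :
    ex (fun p : Finset (Fin n) × Finset (Fin n) => realW a p.1 * realW b p.2)
        (∏ x ∈ B, (fun (i : Fin n) (p : Finset (Fin n) × Finset (Fin n)) => realF i p.1 * realF i p.2) x) = a B * b B := by
  have e1 : (∏ x ∈ B, (fun (i : Fin n) (p : Finset (Fin n) × Finset (Fin n)) => realF i p.1 * realF i p.2) x) =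
      fun p => (∏ x ∈ B, (realF x : Finset (Fin n) → ℝ)) p.1 * (∏ x ∈ B, (realF x : Finset (Fin n) → ℝ)) p.2 := by
    funext p
    rw [Finset.prod_apply, Finset.prod_apply, Finset.prod_apply, ← prod_mul_distrib]
  rw [e1, SahiTotalCumulance.ex_prod_weight]
  have e2 : (fun y => ex (realW a) (fun x => (∏ x ∈ B, (realF x : Finset (Fin n) → ℝ)) x *
      (∏ x ∈ B, (realF x : Finset (Fin n) → ℝ)) y)) =
      fun y => a B * (∏ x ∈ B, (realF x : Finset (Fin n) → ℝ)) y := by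
    funext y
    rw [ex_def, ← PrincipalCapBeta.ex_realW_prod a B, ex_def, sum_mul]
    exact sum_congr rfl fun x _ => by ring
  rw [e2, ex_def]
  have e3 : ∑ y, realW b y * (a B * (∏ x ∈ B, (realF x : Finset (Fin n) → ℝ)) y) =
      a B * ∑ y, realW b y * (∏ x ∈ B, (realF x : Finset (Fin n) → ℝ)) y := by
    rw [mul_sum]; exact sum_congr rfl fun y _ => by ring
  rw [e3, ← ex_def, PrincipalCapBeta.ex_realW_prod]

/-- **Hereditary positivity × quotient positivity ⇒ positivity of the pointwise product (every order).** [this work] -/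
theorem phiSet_mul_nonneg (a b : Finset (Fin (n + 1)) → ℝ)
    (ha : ∀ (L : ℕ) (e : Fin L ↪ Fin (n + 1)), 0 ≤ phiSet L (fun S => a (S.map e)))
    (hb : ∀ (L : ℕ) (B : Fin L → Finset (Fin (n + 1))), (∀ i j, i ≠ j → Disjoint (B i) (B j)) →
      0 ≤ phiSet L (fun Q => b (Q.biUnion B))) :
    0 ≤ phiSet (n + 1) (fun S => a S * b S) := by
  -- `Φ(a·b)` is the Sahi functional of the tensor family in the product of the two signed models
  have hmom : phiSet (n + 1) (fun S => a S * b S) =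
      sahiE (fun p : Finset (Fin (n + 1)) × Finset (Fin (n + 1)) => realW a p.1 * realW b p.2) (n + 1)
        (fun i p => realF i p.1 * realF i p.2) := by
    rw [PrincipalCapBeta.sahiE_eq_phiSet]
    congr 1
    funext B
    exact (ex_tensor_prod a b B).symm
  rw [hmom, SahiTotalCumulance.sahiE_prod_tensor_eq]
  refine sum_nonneg fun c _ => mul_nonneg (prod_nonneg fun m _ => ?_) ?_
  · -- restricted functional of `a` on the block
    exact sahiE_realF_emb_nonneg a _ ((block c m).orderEmbOfFin rfl).toEmbedding (ha _ _)
  · -- quotient functional of `b` along the blocks of `c`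
    have e1 : (fun m (y : Finset (Fin (n + 1))) => ∏ j : Fin (block c m).card, realF ((block c m).orderEmbOfFin rfl j) y) =
        fun m => ∏ i ∈ block c m, (realF i : Finset (Fin (n + 1)) → ℝ) := by
      funext m y
      rw [Finset.prod_apply]
      have h2 : ∏ j : Fin (block c m).card, realF ((block c m).orderEmbOfFin rfl j) y =
          ∏ i ∈ (univ : Finset (Fin (block c m).card)).map ((block c m).orderEmbOfFin rfl).toEmbedding, realF i y := by
        rw [prod_map]; rfl
      rw [h2, Finset.map_orderEmbOfFin_univ]
    rw [e1]
    exact sahiE_realF_blocks_nonneg b c.length (block c) (fun i j hij => block_disjoint c hij)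
      (hb _ _ fun i j hij => block_disjoint c hij)

end PhiProduct

end Summit.CriticalPhenomena.PercolationContinuityZ3.Theorems
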